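import Mathlib
import HarnessLib
import Literature.MathematicalPhysics.QuantumManyBody.BoseEinsteinCondensation
import Literature.MathematicalPhysics.QuantumManyBody.GroundStateFeynmanKacCompact

/-! # NumberPhaseSandwich — calculus for the kinematic (uncertainty) floor (part 1 of 2)

Helper for the crux `FluctuationFloor` (stmt-AtomisticToContinuum-32638) of route NumberPhaseSandwich, near-pivot
stub `stub_floor_nearPivot` (decomp-a2c lens-6 g10; LAND ASK-4b; split at 400 lines by the landing seat). For a trial
state `Ψ` of `N` bosons and a `C²` one-body function `g : ℝ³ → ℝ` this file sets up the «dressed number»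
`G(X) = ∑ₚ g(xₚ)`, its gradient square `|∇G|²`, Laplacian `ΔG` and the gradient pairing `∇G·∇Ψ`, the compact support
of trial states, the per-direction integration by parts `∫ f_{p,j} ∂_{p,j}|Ψ|² = −∫ (∂ⱼg² + (G−a)∂ⱼ∂ⱼg)|Ψ|²`
(Mathlib `integral_mul_fderiv_eq_neg_fderiv_mul_of_integrable`) and a discriminant-form Cauchy–Schwarz for compactly
supported continuous integrands. Part 2 (`NumberPhaseSandwichKinematicFloor`) assembles the commutator identity and the
floor `(∫ |∇G|²|Ψ|²)² ≤ (∫ |G − m|²|Ψ|²)·(2‖∇G·∇Ψ‖₂ + ‖ΔG Ψ‖₂)²`. 0 sorry. -/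

noncomputable section

namespace Summit.AtomisticToContinuum.BoseEinsteinCondensation.Theorems.NumberPhaseSandwichKinematicCalculus

open Literature.MathematicalPhysics.QuantumManyBody.BoseGas MeasureTheory Finset
open scoped NNReal ENNReal

variable {N : ℕ} {L : ℝ}

/-! ## Directions, dressed number, gradient square, Laplacian, gradient pairing -/

/-- unit vector `e_j` of `ℝ³`. -/
def e (j : Fin 3) : Space := EuclideanSpace.single j (1 : ℝ)

/-- configuration-space direction «particle `p`, coordinate `j`». -/
def dirVec (p : Fin N) (j : Fin 3) : Config N := Pi.single p (e j)

/-- `∂_j g (x) := Dg(x) e_j`. -/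
def pd (g : Space → ℝ) (j : Fin 3) (x : Space) : ℝ := fderiv ℝ g x (e j)

/-- the dressed number `G(X) = ∑ₚ g(xₚ)`. -/
def G (g : Space → ℝ) (X : Config N) : ℝ := ∑ p : Fin N, g (X p)

/-- `|∇G|²(X) = ∑ₚ ∑ⱼ (∂ⱼg(xₚ))²`. -/
def gradSq (g : Space → ℝ) (X : Config N) : ℝ := ∑ p : Fin N, ∑ j : Fin 3, (pd g j (X p)) ^ 2

/-- `ΔG(X) = ∑ₚ ∑ⱼ ∂ⱼ∂ⱼ g(xₚ)`. -/
def lapG (g : Space → ℝ) (X : Config N) : ℝ := ∑ p : Fin N, ∑ j : Fin 3, pd (pd g j) j (X p)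

/-- the gradient pairing `(∇G·∇Ψ)(X) = ∑ₚ ∑ⱼ ∂ⱼg(xₚ) · ∂_{p,j}Ψ(X)`. -/
def DPsi (g : Space → ℝ) (ψ : Config N → ℂ) (X : Config N) : ℂ :=
  ∑ p : Fin N, ∑ j : Fin 3, (pd g j (X p) : ℂ) * fderiv ℝ ψ X (dirVec p j)

/-! ## Calculus lemmas -/

/-- chain rule: `Y ↦ g (Y p)` has derivative `Dg(X p) ∘ proj_p` at `X`. -/
theorem hasFDerivAt_comp_eval {g : Space → ℝ} (p : Fin N) (X : Config N) (hg : DifferentiableAt ℝ g (X p)) :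
    HasFDerivAt (fun Y : Config N => g (Y p)) ((fderiv ℝ g (X p)).comp (ContinuousLinearMap.proj p)) X :=
  hg.hasFDerivAt.comp X (hasFDerivAt_apply p X)

/-- the `p`-th coordinate of the direction `dirVec p' j` is `e j` if `p = p'` and `0` otherwise. -/
theorem proj_dirVec (p p' : Fin N) (j : Fin 3) :
    (ContinuousLinearMap.proj (R := ℝ) (φ := fun _ : Fin N => Space) p) (dirVec p' j) =
      if p = p' then e j else 0 := by
  simp only [ContinuousLinearMap.proj_apply, dirVec]
  by_cases h : p = p'
  · subst h; simp
  · simp [h]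

/-- directional derivative of `Y ↦ g (Y p)` along `dirVec p' j`: `∂ⱼg(X p)` if `p = p'`, else `0`. -/
theorem fderiv_comp_eval_dirVec {g : Space → ℝ} (p p' : Fin N) (j : Fin 3) (X : Config N)
    (hg : DifferentiableAt ℝ g (X p)) :
    fderiv ℝ (fun Y : Config N => g (Y p)) X (dirVec p' j) = if p = p' then pd g j (X p) else 0 := by
  rw [(hasFDerivAt_comp_eval p X hg).fderiv, ContinuousLinearMap.comp_apply, proj_dirVec]
  split_ifs <;> simp [pd]

/-- `Y ↦ g (Y p)` is differentiable when `g` is. -/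
theorem differentiableAt_comp_eval {g : Space → ℝ} (hg : Differentiable ℝ g) (p : Fin N) (X : Config N) :
    DifferentiableAt ℝ (fun Y : Config N => g (Y p)) X :=
  (hasFDerivAt_comp_eval p X (hg (X p))).differentiableAt

/-- the dressed number `G g` is differentiable when `g` is. -/
theorem differentiable_G {g : Space → ℝ} (hg : Differentiable ℝ g) : Differentiable ℝ (G (N := N) g) := by
  intro X
  unfold G
  exact DifferentiableAt.fun_sum fun p _ => differentiableAt_comp_eval hg p X

/-- `∂_{p,j} G(X) = ∂ⱼ g(X p)`. -/
theorem fderiv_G_dirVec {g : Space → ℝ} (hg : Differentiable ℝ g) (p : Fin N) (j : Fin 3) (X : Config N) :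
    fderiv ℝ (G g) X (dirVec p j) = pd g j (X p) := by
  unfold G
  rw [fderiv_fun_sum fun p' _ => differentiableAt_comp_eval hg p' X]
  simp only [FunLike.coe_sum, Finset.sum_apply]
  rw [Finset.sum_eq_single p]
  · rw [fderiv_comp_eval_dirVec p p j X (hg _)]; simp
  · intro p' _ hp'; rw [fderiv_comp_eval_dirVec p' p j X (hg _)]; simp [hp']
  · simp

/-- partial derivatives of a `C¹` function are continuous. -/
theorem continuous_pd {g : Space → ℝ} (hg : ContDiff ℝ 1 g) (j : Fin 3) : Continuous (pd g j) :=
  (hg.continuous_fderiv one_ne_zero).clm_apply continuous_const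

/-- partial derivatives of a `C²` function are `C¹`. -/
theorem contDiff_pd {g : Space → ℝ} (hg : ContDiff ℝ 2 g) (j : Fin 3) : ContDiff ℝ 1 (pd g j) := by
  unfold pd
  have := hg.fderiv_right (m := 1) (by norm_num)
  exact this.clm_apply contDiff_const

/-- `D(‖ψ‖²)(X) v = 2 Re (conj ψ(X) · Dψ(X) v)`. -/
theorem norm_sq_fderiv {ψ : Config N → ℂ} (X v : Config N) (hψ : DifferentiableAt ℝ ψ X) :
    fderiv ℝ (fun X => ‖ψ X‖ ^ 2) X v = 2 * ((starRingEnd ℂ) (ψ X) * fderiv ℝ ψ X v).re := by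
  rw [(hψ.hasFDerivAt.norm_sq).fderiv]
  simp [Complex.inner, mul_comm]; ring

/-! ## Compact support of trial states -/

/-- a trial state has compact support (it vanishes off the bounded box). -/
theorem hasCompactSupport_psi (Ψ : TrialState N L) : HasCompactSupport Ψ.ψ := by
  refine HasCompactSupport.of_support_subset_isCompact (isBounded_boxN N L).isCompact_closure ?_
  intro X hX
  exact subset_closure (by by_contra h; exact hX (Ψ.eq_zero X h))

/-- `‖Ψ‖²` has compact support. -/
theorem hasCompactSupport_normSq (Ψ : TrialState N L) : HasCompactSupport fun X => ‖Ψ.ψ X‖ ^ 2 :=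
  (hasCompactSupport_psi Ψ).norm.comp_left (g := fun t : ℝ => t ^ 2) (by simp)

/-- `‖Ψ‖²` is `C¹`. -/
theorem contDiff_normSq (Ψ : TrialState N L) : ContDiff ℝ 1 fun X => ‖Ψ.ψ X‖ ^ 2 := Ψ.contDiff.norm_sq ℝ

/-- directional derivatives of a trial state are continuous. -/
theorem continuous_fderiv_psi (Ψ : TrialState N L) (v : Config N) : Continuous fun X => fderiv ℝ Ψ.ψ X v :=
  (Ψ.contDiff.continuous_fderiv one_ne_zero).clm_apply continuous_const

/-- directional derivatives of a trial state have compact support. -/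
theorem hasCompactSupport_fderiv_psi (Ψ : TrialState N L) (v : Config N) :
    HasCompactSupport fun X => fderiv ℝ Ψ.ψ X v :=
  (hasCompactSupport_psi Ψ).fderiv_apply (𝕜 := ℝ) v

/-! ## The integration-by-parts identity, one direction `(p, j)` at a time -/

section IBP
variable (Ψ : TrialState N L) {g : Space → ℝ} (hg : ContDiff ℝ 2 g) (a : ℝ)
include hg

/-- the scalar factor `f_{p,j}(X) = (G(X) − a) · ∂ⱼg(xₚ)`. -/
def fpj (g : Space → ℝ) (a : ℝ) (p : Fin N) (j : Fin 3) (X : Config N) : ℝ := (G g X - a) * pd g j (X p)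

/-- the factor `f_{p,j}` is differentiable. -/
theorem differentiable_fpj (p : Fin N) (j : Fin 3) : Differentiable ℝ (fpj (N := N) g a p j) := by
  intro X
  unfold fpj
  refine ((differentiable_G (hg.differentiable (by norm_num)) X).sub_const a).mul ?_
  exact differentiableAt_comp_eval ((contDiff_pd hg j).differentiable one_ne_zero) p X

/-- the factor `f_{p,j}` is continuous. -/
theorem continuous_fpj (p : Fin N) (j : Fin 3) : Continuous (fpj (N := N) g a p j) :=
  (differentiable_fpj hg a p j).continuous

/-- `∂_{p,j} f_{p,j}(X) = ∂ⱼg(xₚ)² + (G(X) − a) ∂ⱼ∂ⱼg(xₚ)`. -/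
theorem fderiv_fpj (p : Fin N) (j : Fin 3) (X : Config N) :
    fderiv ℝ (fpj g a p j) X (dirVec p j) = pd g j (X p) ^ 2 + (G g X - a) * pd (pd g j) j (X p) := by
  unfold fpj
  have h1 : DifferentiableAt ℝ (fun Y : Config N => G g Y - a) X := (differentiable_G (hg.differentiable (by norm_num)) X).sub_const a
  have h2 : DifferentiableAt ℝ (fun Y : Config N => pd g j (Y p)) X :=
    differentiableAt_comp_eval ((contDiff_pd hg j).differentiable one_ne_zero) p X
  rw [fderiv_fun_mul h1 h2]
  simp only [add_apply, FunLike.coe_smul, Pi.smul_apply, smul_eq_mul]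
  rw [fderiv_sub_const, fderiv_G_dirVec (hg.differentiable (by norm_num)),
    fderiv_comp_eval_dirVec p p j X (((contDiff_pd hg j).differentiable one_ne_zero) _)]
  (try rw [if_pos rfl]); ring

/-- `X ↦ ∂_{p,j} f_{p,j}(X)` is continuous. -/
theorem continuous_fderiv_fpj (p : Fin N) (j : Fin 3) :
    Continuous fun X : Config N => fderiv ℝ (fpj g a p j) X (dirVec p j) := by
  simp_rw [fderiv_fpj hg a p j]
  have hc1 : Continuous (pd g j) := continuous_pd (hg.of_le (by norm_num)) j
  have hc2 : Continuous (pd (pd g j) j) := continuous_pd (contDiff_pd hg j) j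
  have hG : Continuous (G (N := N) g) := (differentiable_G (hg.differentiable (by norm_num))).continuous
  fun_prop

/-- Integration by parts in the direction `(p, j)`:
`∫ f_{p,j} · ∂_{p,j}|Ψ|² = −∫ (∂ⱼg(xₚ)² + (G − a)∂ⱼ∂ⱼg(xₚ)) |Ψ|²`. -/
theorem ibp_pj (p : Fin N) (j : Fin 3) :
    ∫ X, fpj g a p j X * fderiv ℝ (fun X => ‖Ψ.ψ X‖ ^ 2) X (dirVec p j) =
      - ∫ X, (pd g j (X p) ^ 2 + (G g X - a) * pd (pd g j) j (X p)) * ‖Ψ.ψ X‖ ^ 2 := by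
  have hw : ContDiff ℝ 1 fun X => ‖Ψ.ψ X‖ ^ 2 := contDiff_normSq Ψ
  have hwc := hasCompactSupport_normSq Ψ
  have hwd : Continuous fun X => fderiv ℝ (fun X => ‖Ψ.ψ X‖ ^ 2) X (dirVec p j) :=
    (hw.continuous_fderiv one_ne_zero).clm_apply continuous_const
  have hwdc : HasCompactSupport fun X => fderiv ℝ (fun X => ‖Ψ.ψ X‖ ^ 2) X (dirVec p j) :=
    hwc.fderiv_apply (𝕜 := ℝ) (dirVec p j)
  have key := integral_mul_fderiv_eq_neg_fderiv_mul_of_integrable (μ := (volume : Measure (Config N)))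
    (f := fpj g a p j) (g := fun X => ‖Ψ.ψ X‖ ^ 2) (v := dirVec p j) ?_ ?_ ?_ ?_ ?_
  · rw [key]; congr 1
    refine integral_congr_ae (Filter.Eventually.of_forall fun X => ?_)
    show fderiv ℝ (fpj g a p j) X (dirVec p j) * ‖Ψ.ψ X‖ ^ 2 = _
    rw [fderiv_fpj hg a p j X]
  · exact ((continuous_fderiv_fpj hg a p j).mul hw.continuous).integrable_of_hasCompactSupport hwc.mul_left
  · exact ((continuous_fpj hg a p j).mul hwd).integrable_of_hasCompactSupport hwdc.mul_left
  · exact ((continuous_fpj hg a p j).mul hw.continuous).integrable_of_hasCompactSupport hwc.mul_left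
  · exact fun X _ => differentiable_fpj hg a p j X
  · exact fun X _ => hw.differentiable one_ne_zero X

end IBP



/-! ## Cauchy–Schwarz for compactly supported continuous integrands (discriminant form) -/

/-- a product of continuous functions, one compactly supported, is integrable. -/
theorem integrable_mul_of_cs {F H : Config N → ℝ} (hF : Continuous F) (hH : Continuous H)
    (hHc : HasCompactSupport H) : Integrable (fun X => F X * H X) :=
  (hF.mul hH).integrable_of_hasCompactSupport hHc.mul_left

/-- the square of a compactly supported continuous function is integrable. -/
theorem integrable_sq_of_cs {F : Config N → ℝ} (hF : Continuous F) (hFc : HasCompactSupport F) :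
    Integrable (fun X => F X ^ 2) := by
  refine (integrable_mul_of_cs hF hF hFc).congr (Filter.Eventually.of_forall fun X => ?_)
  show F X * F X = F X ^ 2
  ring

/-- `∫ (tF − H)² = t² ∫F² − 2t ∫FH + ∫H²` for compactly supported continuous `F, H`. -/
theorem integral_quad_expand {F H : Config N → ℝ} (hF : Continuous F) (hH : Continuous H)
    (hFc : HasCompactSupport F) (hHc : HasCompactSupport H) (t : ℝ) :
    ∫ X, (t * F X - H X) ^ 2 = t ^ 2 * (∫ X, F X ^ 2) - 2 * t * (∫ X, F X * H X) + ∫ X, H X ^ 2 := by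
  have hiFH : Integrable (fun X => F X * H X) := integrable_mul_of_cs hF hH hHc
  have hiF2 : Integrable (fun X => F X ^ 2) := integrable_sq_of_cs hF hFc
  have hiH2 : Integrable (fun X => H X ^ 2) := integrable_sq_of_cs hH hHc
  have h2 : Integrable (fun X => t ^ 2 * F X ^ 2) := hiF2.const_mul (t ^ 2)
  have h3 : Integrable (fun X => 2 * t * (F X * H X)) := hiFH.const_mul (2 * t)
  have h1 : Integrable (fun X => t ^ 2 * F X ^ 2 - 2 * t * (F X * H X)) := h2.sub h3
  have hpt : ∀ X, (t * F X - H X) ^ 2 = t ^ 2 * F X ^ 2 - 2 * t * (F X * H X) + H X ^ 2 :=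
    fun X => by ring
  have i2 : ∫ X, t ^ 2 * F X ^ 2 = t ^ 2 * ∫ X, F X ^ 2 := integral_const_mul _ _
  have i3 : ∫ X, 2 * t * (F X * H X) = 2 * t * ∫ X, F X * H X := integral_const_mul _ _
  calc ∫ X, (t * F X - H X) ^ 2
      = ∫ X, (t ^ 2 * F X ^ 2 - 2 * t * (F X * H X) + H X ^ 2) :=
        integral_congr_ae (Filter.Eventually.of_forall hpt)
    _ = (∫ X, (t ^ 2 * F X ^ 2 - 2 * t * (F X * H X))) + ∫ X, H X ^ 2 := integral_add h1 hiH2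
    _ = ((∫ X, t ^ 2 * F X ^ 2) - ∫ X, 2 * t * (F X * H X)) + ∫ X, H X ^ 2 := by
        rw [integral_sub h2 h3]
    _ = t ^ 2 * (∫ X, F X ^ 2) - 2 * t * (∫ X, F X * H X) + ∫ X, H X ^ 2 := by rw [i2, i3]

/-- Cauchy–Schwarz for compactly supported continuous real integrands (discriminant proof). -/
theorem cs_integral {F H : Config N → ℝ} (hF : Continuous F) (hH : Continuous H)
    (hFc : HasCompactSupport F) (hHc : HasCompactSupport H) :
    (∫ X, F X * H X) ^ 2 ≤ (∫ X, F X ^ 2) * (∫ X, H X ^ 2) := by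
  have hq : ∀ t : ℝ, 0 ≤ (∫ X, F X ^ 2) * (t * t) + (-2 * ∫ X, F X * H X) * t + ∫ X, H X ^ 2 := by
    intro t
    have h0 : 0 ≤ ∫ X, (t * F X - H X) ^ 2 := integral_nonneg fun X => sq_nonneg _
    rw [integral_quad_expand hF hH hFc hHc t] at h0
    linarith
  have hd := discrim_le_zero hq
  rw [discrim] at hd
  nlinarith [hd]

/-- `|∫ F H| ≤ ‖F‖₂ ‖H‖₂` for compactly supported continuous real `F, H`. -/
theorem abs_integral_mul_le {F H : Config N → ℝ} (hF : Continuous F) (hH : Continuous H)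
    (hFc : HasCompactSupport F) (hHc : HasCompactSupport H) :
    |∫ X, F X * H X| ≤ Real.sqrt (∫ X, F X ^ 2) * Real.sqrt (∫ X, H X ^ 2) := by
  rw [← Real.sqrt_mul (integral_nonneg fun X => sq_nonneg _)]
  exact Real.abs_le_sqrt (cs_integral hF hH hFc hHc)

/-! ## Continuity / support of the assembled integrands -/

/-- Pointwise conversion between the `ℝ≥0∞`-valued weight of the route's variance object and `ENNReal.ofReal`. -/
theorem nnnorm_sq_mul_nnnorm_sq (z w : ℂ) :
    (‖z‖₊ : ℝ≥0∞) ^ 2 * (‖w‖₊ : ℝ≥0∞) ^ 2 = ENNReal.ofReal (‖z‖ ^ 2 * ‖w‖ ^ 2) := by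
  rw [← enorm_eq_nnnorm, ← enorm_eq_nnnorm, ← ofReal_norm, ← ofReal_norm,
    ← ENNReal.ofReal_pow (norm_nonneg _), ← ENNReal.ofReal_pow (norm_nonneg _),
    ← ENNReal.ofReal_mul (sq_nonneg _)]


end Summit.AtomisticToContinuum.BoseEinsteinCondensation.Theorems.NumberPhaseSandwichKinematicCalculus

end
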